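import Literature.Computability.AlgebraicComplexity.PermanentBitsPPoly
import Literature.Computability.AlgebraicComplexity.BurgisserThm210Proofs
import Literature.Computability.AlgebraicComplexity.CircuitArithmetizationTau
import Literature.Computability.Complexity.CircuitClassesUniformProofs
import HarnessLib

/-!
# `τ(PER_n) = n^{O(1)}` puts `#P` in `FP/poly`: discharge of Bürgisser's Lemma 2.12

This file PROVES the named fact
`Literature.Computability.AlgebraicComplexity.PP_subset_PPoly_of_isPBounded_perPoly`
(`TauConjectureProofs.lean`) — Bürgisser, *On defining integers in the counting hierarchy and
proving lower bounds in algebraic complexity*, ECCC TR06-113 (2006), Lemma 2.12, p. 8 (= STACS 2007,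
LNCS 4393, Lemma 11; Comput. Complexity 18 (2009)): "`τ(Per_n) = n^{O(1)}` implies that
`PP ⊆ P/poly`" — as the theorem `PP_subset_PPoly_of_isPBounded_perPoly_holds`, with no hypothesis.

## The printed proof and the proof given here

Printed proof (TR06-113, p. 8): "Suppose there is a family `(C_n)` of constant-free and
division-free arithmetic circuits of polynomial size such that `C_n` computes the permanent `Per_n`.
Let `p_n` be a prime such that `n! < p_n ≤ 2^{n^{O(1)}}` (`p_n` is interpreted as a polynomial advice
for input size `n`). On an input `A ∈ {0,1}^{n×n}`, we execute the arithmetic circuit `C_n` in the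
finite field `𝔽_{p_n}`. This computation can clearly be simulated by a Boolean circuit of polynomial
size. Moreover, the result `Per(A) mod p_n` the integer value of the permanent of `A` can be
retrieved. Since the computation of the permanent of matrices with entries in `{0,1}` is
`#P`-complete [27 = Valiant 1979], we conclude `PP ⊆ P/poly`."

`PermanentBitsPPoly.lean` formalises this route up to its last sentence, Valiant's BOOLEAN
completeness theorem (named fact `Valiant1979_per01Plain_isSharpPHardFun`, not proved in the tree).
Here that sentence is replaced by Valiant's ALGEBRAIC completeness theorem in its constant-free
form, which IS proved in the tree as the content of Bürgisser's Thm. 2.10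
(`ArithCircuit.exists_permanent_boolSum`, `BurgisserThm210Proofs.lean`: the Boolean sum of a
constant-free fan-in-two circuit `P(X, e)` over `e ∈ {0,1}^u` is `2^{-K} per(B)` for a matrix `B` of
polynomial size with entries `0, ±1, X_v` or cheap constants), combined with Valiant's criterion
(transcript arithmetisation, `CircuitArithmetization[Tau].lean`). For a `#P` function
`f(x) = #{y ∈ {0,1}^{p(|x|)} | ⟨x, y⟩ ∈ R}`, `R ∈ P`, at input length `n` (`m = p(n)`):
(1) `P ⊆ P/poly` gives a `B₂`-circuit `Q` of polynomial size for `(x, y) ↦ [⟨x, y⟩ ∈ R]`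
(`exists_cktSize_boolPair_of_mem_PPoly`); (2) its transcript arithmetisation `G` (`exists_countPoly`),
with the certificate bits and the gate bits as Boolean-sum variables, is constant-free of size
`60 |Q| + 1`, formal degree `3 |Q| + 2`, and its Boolean sum takes the value `f(x)` at `x ∈ {0,1}ⁿ`;
(3) `per(B) = 2^K · ∑_e G(X, e)` with `B` an `N × N` matrix over `ℤ[X]`, `N + K` polynomial,
entries of `τ`-cost `≤ 60 |Q| + 2`, so `τ(per B) ≤ τ(PER_N) + N² (60 |Q| + 2)`
(`constantFreeComplexity_permanent_le`) is polynomial under `τ(PER_N) = N^{O(1)}` — "execute the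
arithmetic circuit `C_N`" on `B(x)`; (4) the optimal constant-free circuit for `per B` at
`x ∈ {0,1}ⁿ` is simulated modulo `2^ℓ`, `ℓ = K + m + 1 > log₂ (2^K f(x))` (in place of the prime
`p_n > n!`; no advice is needed beyond non-uniformity), by Boolean circuits of polynomial size
(`cktSize_testBits_aeval_eval`, `BurgisserBooleanPartsModPCircuits.lean`), and bits `K, …, K + m` of
the result are the bits of `f(x)` ("the integer value … can be retrieved"); (5) hence `f ∈ FP/poly`
(`BitCircuits f`), `P^f ⊆ P/poly` (`BitGraphPPoly.lean`), `P^{#P} ⊆ P/poly`, and with `PP ⊆ P^{#P}`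
(`PP_subset_PSharpP_holds`; TR06-113 p. 5) `PP ⊆ P/poly`. Steps 3–5 are the printed argument with
`A ↦ B(x)`; steps 1–2 with the algebraic completeness theorem stand in for the citation of [27].
The statement discharged is exactly the def of `TauConjectureProofs.lean`. Main statements:
`cktSize_testBit_countWitnesses` (fixed-length core), `sharpP_bitCircuits_of_isPBounded_perPoly`
(`#P ⊆ FP/poly`), `PSharpP_subset_PPoly_of_isPBounded_perPoly` (`P^{#P} ⊆ P/poly`),
`PP_subset_PPoly_of_isPBounded_perPoly_holds` (the discharge, D-0014).

## References

* P. Bürgisser, *On defining integers in the counting hierarchy and proving lower bounds in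
  algebraic complexity*, ECCC TR06-113 (2006), Lemma 2.12 (p. 8), Thm. 2.10 (p. 8), §2.1 (p. 5);
  STACS 2007, LNCS 4393, 133–144, Lemma 11; journal version Comput. Complexity 18 (2009) 81–103.
* L. G. Valiant, *Completeness classes in algebra*, STOC 1979; P. Bürgisser, *Completeness and
  Reduction in Algebraic Complexity Theory*, Springer 2000, Prop. 2.20 (Valiant's criterion).
* S. Arora, B. Barak, *Computational Complexity* (2009), Thm. 6.6 (`P ⊆ P/poly`), §17.2.1.
-/

noncomputable section

namespace Literature.Computability.AlgebraicComplexity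

open MvPolynomial Complexity ArithCircuit CircuitArith _root_.Computability

/-! ### Counting accepted certificates of a fixed length -/

/-- The tree's `countWitnesses R m x = #{y ∈ {0,1}^m | ⟨x, y⟩ ∈ R}` (over `List.Vector Bool m`) as a
count over bit functions `Fin m → Bool`, for any predicate equivalent to `⟨x, y⟩ ∈ R`
(Bürgisser, ECCC TR06-113, §2.1, p. 5: the `#P` function of `R`). [cite: Burgisser2006, §2.1] -/
theorem countWitnesses_eq_card_filter (R : Language Bool) (m : ℕ) (x : List Bool)
    (p : (Fin m → Bool) → Prop) [DecidablePred p] (hp : ∀ y, p y ↔ boolPair x (List.ofFn y) ∈ R) :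
    countWitnesses R m x = (Finset.univ.filter p).card := by
  classical
  unfold countWitnesses
  refine Finset.card_bij (fun v _ => v.get) (fun v hv => ?_) (fun v _ w _ h => List.Vector.ext fun i => congrFun h i)
    (fun y hy => ⟨List.Vector.ofFn y, ?_, funext (List.Vector.get_ofFn y)⟩)
  · simp only [Finset.mem_filter, Finset.mem_univ, true_and] at hv ⊢
    rw [hp, ← List.Vector.toList_ofFn v.get, List.Vector.ofFn_get]
    exact hv
  · simp only [Finset.mem_filter, Finset.mem_univ, true_and] at hy ⊢
    rw [hp] at hy
    rwa [List.Vector.toList_ofFn]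

/-! ### Step 2: the transcript arithmetisation with certificate and gate bits as Boolean-sum variables -/

/-- The transcript arithmetisation `arith Q = VALID · OUT` itself is constant-free of size
`60 |Q| + 1` and formal degree `3 |Q| + 2` (the identity substitution in
`CircuitArith.hasTauDeg_aeval_arith`). [cite: Burgisser2000, proof of Prop. 2.20] -/
theorem hasTauDeg_arith {ι : Type} (Q : Circuit ι) :
    HasTauDeg (arith (k := ℤ) Q) (60 * Q.size + 1) (3 * Q.size + 2) := by
  have h := hasTauDeg_aeval_arith Q (g := X) fun v => HasTauDeg.X v
  rwa [aeval_X_left_apply] at h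

/-- **The counting polynomial of a circuit on pairs** (Valiant's criterion applied to a
`B₂`-circuit `Q` on `{0,1}ⁿ × {0,1}^m`; Bürgisser 2000, proof of Prop. 2.20): the transcript
arithmetisation `G = (arith Q)(x, (y, w))`, in the parameters `x` and ONE Boolean-sum block made of
the certificate bits `y` and the gate bits `w ∈ {0,1}^{|Q|}`, is constant-free of size `60 |Q| + 1`
and formal degree `3 |Q| + 2`, and its Boolean sum counts accepted certificates:
`∑_{(y, w)} G(x, y, w) = ∑_y [Q(x, y)] = #{y ∈ {0,1}^m | Q(x, y) = 1}` at `x ∈ {0,1}ⁿ`. [cite: Burgisser2000, Prop. 2.20] -/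
theorem exists_countPoly {n m : ℕ} (Q : Circuit (Fin n ⊕ Fin m)) (hQ : Q.IsOver B2) :
    ∃ G : MvPolynomial (Fin n ⊕ Fin (m + Q.size)) ℤ, HasTauDeg G (60 * Q.size + 1) (3 * Q.size + 2) ∧
      ∀ x : Fin n → Bool, eval (toK ℤ ∘ x) (boolSum G) =
        ((Finset.univ.filter fun y : Fin m → Bool => Q.eval (Sum.elim x y) = true).card : ℤ) := by
  classical
  -- regroup the variables `((x, y), w) ↦ (x, (y, w))`
  set vm : (Fin n ⊕ Fin m) ⊕ Fin Q.size → Fin n ⊕ Fin (m + Q.size) :=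
    Sum.elim (Sum.map id (Fin.castAdd Q.size)) fun j => Sum.inr (Fin.natAdd m j) with hvm
  refine ⟨rename vm (arith (k := ℤ) Q), (hasTauDeg_arith Q).rename vm, fun x => ?_⟩
  unfold boolSum
  rw [map_sum]
  -- each summand is `arith Q` at the Boolean point `((x, y), w)`, `e = (y, w)`
  have h1 : ∀ e : Fin (m + Q.size) → Bool,
      eval (toK ℤ ∘ x) (aeval (Sum.elim X fun j => if e j then (1 : MvPolynomial (Fin n) ℤ) else 0)
          (rename vm (arith (k := ℤ) Q))) =
        eval (bpt ℤ (Sum.elim x fun i => e (Fin.castAdd Q.size i)) fun j => e (Fin.natAdd m j)) (arith Q) := by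
    intro e
    rw [aeval_rename, aeval_eq_bind₁,
      show eval (toK ℤ ∘ x) (bind₁ ((Sum.elim X fun j => if e j then (1 : MvPolynomial (Fin n) ℤ) else 0) ∘ vm)
          (arith Q)) =
        eval (fun i => eval (toK ℤ ∘ x) (((Sum.elim X fun j => if e j then (1 : MvPolynomial (Fin n) ℤ) else 0) ∘
          vm) i)) (arith Q) from eval₂Hom_bind₁ _ _ _ _]
    have hpt : (fun i => eval (toK ℤ ∘ x) (((Sum.elim X fun j => if e j then (1 : MvPolynomial (Fin n) ℤ) else 0) ∘
          vm) i)) = bpt ℤ (Sum.elim x fun i => e (Fin.castAdd Q.size i)) fun j => e (Fin.natAdd m j) := by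
      funext i
      rcases i with (i | i) | j
      · simp [hvm, bpt]
      · by_cases h : e (Fin.castAdd Q.size i) <;> simp [hvm, bpt, toK, h]
      · by_cases h : e (Fin.natAdd m j) <;> simp [hvm, bpt, toK, h]
    rw [hpt]
  simp only [h1]
  -- split the Boolean block `e = (y, w)` and apply the transcript sum in `w`
  rw [show (∑ e : Fin (m + Q.size) → Bool,
        eval (bpt ℤ (Sum.elim x fun i => e (Fin.castAdd Q.size i)) fun j => e (Fin.natAdd m j)) (arith Q)) =
      ∑ y : Fin m → Bool, ∑ w : Fin Q.size → Bool, eval (bpt ℤ (Sum.elim x y) w) (arith Q) from by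
    rw [← Fintype.sum_prod_type']
    exact Fintype.sum_equiv (Fin.appendEquiv m Q.size).symm _ _ fun e => by simp [Fin.appendEquiv]]
  simp only [sum_eval_arith Q hQ, toK]
  rw [Finset.sum_boole]

/-! ### Step 3: cost of the entries of the permanent form; the size bound -/

/-- An entry of the matrix of `exists_permanent_boolSum` (`GoodParam s`: `0, ±1`, a variable, or a
constant of `τ`-cost `≤ s`) has `τ`-cost `≤ s + 1`. [cite: Burgisser2006, proof of Thm. 2.10] -/
theorem ArithCircuit.GoodParam.constantFreeComplexity_le_succ {S : Type} {s : ℕ} {a : MvPolynomial S ℤ}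
    (ha : GoodParam s a) : constantFreeComplexity a ≤ s + 1 := by
  rcases ha with rfl | rfl | rfl | ⟨v, rfl⟩ | ⟨c, rfl, hc⟩
  · rw [constantFreeComplexity_zero]; exact Nat.zero_le _
  · rw [constantFreeComplexity_one]; exact Nat.zero_le _
  · rw [show (-1 : MvPolynomial S ℤ) = C (-1) by simp, constantFreeComplexity_C_neg_one]; exact Nat.zero_le _
  · rw [constantFreeComplexity_X]; exact Nat.zero_le _
  · exact hc.trans (Nat.le_succ _)

/-- `cfBound` is monotone in the size, the formal degree and the number of Boolean variables. [folklore] -/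
theorem cfBound_mono {s s' δ δ' u u' : ℕ} (hs : s ≤ s') (hδ : δ ≤ δ') (hu : u ≤ u') :
    cfBound s δ u ≤ cfBound s' δ' u' := by
  unfold cfBound
  gcongr

/-- **The size of the bit circuits is p-bounded**: with `CF(n) = cfBound (60 S + 1) (3 S + 2) (p + S)`
(the bound on `N + K`), the size `(CF^c + c + CF² (60 S + 2) + 1) · (2 + 65 (CF + p + 3)³)` of
`cktSize_testBit_countWitnesses` is p-bounded along p-bounded certificate length `p` and
pair-circuit size `S`. [folklore] -/
theorem isPBounded_size212 (c : ℕ) {p S : ℕ → ℕ} (hp : IsPBounded p) (hS : IsPBounded S) :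
    IsPBounded fun n =>
      (cfBound (60 * S n + 1) (3 * S n + 2) (p n + S n) ^ c + c +
          cfBound (60 * S n + 1) (3 * S n + 2) (p n + S n) * cfBound (60 * S n + 1) (3 * S n + 2) (p n + S n) *
            (60 * S n + 2) + 1) *
        (2 + 65 * (cfBound (60 * S n + 1) (3 * S n + 2) (p n + S n) + p n + 3) ^ 3) := by
  have h : IsPBounded fun n => cfBound (60 * S n + 1) (3 * S n + 2) (p n + S n) :=
    isPBounded_cfBound
      (IsPBounded.add_holds (IsPBounded.mul_holds (IsPBounded.const 60) hS) (IsPBounded.const 1))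
      (IsPBounded.add_holds (IsPBounded.mul_holds (IsPBounded.const 3) hS) (IsPBounded.const 2))
      (IsPBounded.add_holds hp hS)
  exact IsPBounded.mul_holds
    (IsPBounded.add_holds
      (IsPBounded.add_holds (IsPBounded.add_holds (IsPBounded.pow_holds h c) (IsPBounded.const c))
        (IsPBounded.mul_holds (IsPBounded.mul_holds h h)
          (IsPBounded.add_holds (IsPBounded.mul_holds (IsPBounded.const 60) hS) (IsPBounded.const 2))))
      (IsPBounded.const 1))
    (IsPBounded.add_holds (IsPBounded.const 2)
      (IsPBounded.mul_holds (IsPBounded.const 65)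
        (IsPBounded.pow_holds (IsPBounded.add_holds (IsPBounded.add_holds h hp) (IsPBounded.const 3)) 3)))

/-! ### Step 4: feeding input bits as residues, reading integer values modulo `2^ℓ` -/

/-- A `0/1` input bit as a residue modulo `2^ℓ`: bit `0` is the input wire, the other bits are `0`
(one constant gate; generic-index form of `cktSize_inputResidue` of `PermanentBitsPPoly.lean`). [folklore] -/
theorem cktSize_inputResidue' {ι : Type*} {ℓ : ℕ} (hℓ : 1 ≤ ℓ) (v : ι) :
    CktSize B2 (fun (y : ι → Bool) => testBits ℓ (if y v then (1 : ZMod (2 ^ ℓ)) else 0).val) 1 := by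
  haveI : Fact (1 < 2 ^ ℓ) := ⟨Nat.one_lt_two_pow (by omega)⟩
  have h := ((CktSize.proj B2 fun _ : Unit => v).pair (cktSize_const ι false)).outMap
    (fun i : Fin ℓ => if i.val = 0 then Sum.inl () else Sum.inr ())
  refine (h.congr fun y i => ?_).of_le (by norm_num)
  by_cases hi : i.val = 0
  · simp only [hi, if_true, Sum.elim_inl, testBits_apply]
    cases y v
    · simp
    · simp [ZMod.val_one]
  · simp only [hi, if_false, Sum.elim_inr, testBits_apply]
    cases y v
    · simp
    · rw [if_pos rfl, ZMod.val_one, ← Nat.pow_zero 2, Nat.testBit_two_pow_of_ne (Ne.symm hi)]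

/-- Integer polynomials at integer points, read in a ring `A`: `aeval` at the cast point is the cast
of the integer value. [folklore] -/
theorem aeval_intCast_point {σ : Type*} (A : Type*) [CommRing A] (z : σ → ℤ) (h : MvPolynomial σ ℤ) :
    aeval (fun v => (z v : A)) h = ((eval z h : ℤ) : A) := by
  have key := MvPolynomial.eval₂_comp_left (Int.castRingHom A) (RingHom.id ℤ) z h
  rw [RingHom.comp_id, Int.coe_castRingHom] at key
  rw [MvPolynomial.aeval_def, algebraMap_int_eq, MvPolynomial.eval, MvPolynomial.coe_eval₂Hom]
  exact key.symm

/-! ### The fixed-length core: bits of the certificate count by polynomial-size circuits -/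

/-- **Bits of `#{y | ⟨x, y⟩ ∈ R}` by Boolean circuits, under `τ(PER_N) ≤ N^c + c`** (Bürgisser,
ECCC TR06-113, proof of Lemma 2.12, with the algebraic completeness of the permanent in place of
[27]): from a `B₂`-program of size `S` for `(x, y) ↦ [⟨x, y⟩ ∈ R]` on `{0,1}ⁿ × {0,1}^m` and any
`CF ≥ cfBound (60 S + 1) (3 S + 2) (m + S)`, the `m + 1` bits of
`x ↦ #{y ∈ {0,1}^m | ⟨x, y⟩ ∈ R}` have `B₂`-circuits of size
`(CF^c + c + CF² (60 S + 2) + 1) · (2 + 65 (CF + m + 3)³)`: arithmetise (`exists_countPoly`), write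
the Boolean sum as `2^{-K} per B` (`exists_permanent_boolSum`, `N + K ≤ CF`), take an optimal
constant-free circuit for `per B` (`τ ≤ τ(PER_N) + N² (60 S + 2)`), simulate it modulo `2^{K+m+1}`
(`cktSize_testBits_aeval_eval`) and output bits `K, …, K + m`. [cite: Burgisser2006, Lemma 2.12] -/
theorem cktSize_testBit_countWitnesses {c : ℕ}
    (hc : ∀ N, constantFreeComplexity (perPoly (Fin N) ℤ) ≤ N ^ c + c) (R : Language Bool) (n m S CF : ℕ)
    (hCF : cfBound (60 * S + 1) (3 * S + 2) (m + S) ≤ CF)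
    (hR : CktSize B2 (fun (w : Fin n ⊕ Fin m → Bool) (_ : Unit) =>
      R.boolIndicator (boolPair (List.ofFn fun i => w (.inl i)) (List.ofFn fun j => w (.inr j)))) S) :
    CktSize B2 (fun (x : Fin n → Bool) (i : Fin (m + 1)) => (countWitnesses R m (List.ofFn x)).testBit i)
      ((CF ^ c + c + CF * CF * (60 * S + 2) + 1) * (2 + 65 * (CF + m + 3) ^ 3)) := by
  classical
  -- [1] the circuit for `R` on pairs
  obtain ⟨Q, hQB, hQs, hQe⟩ := hR.toCircuit
  -- [2] the counting polynomial and its constant-free circuit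
  obtain ⟨G, ⟨P, hP2, hPc, hPe, hPs, hPd⟩, hG⟩ := exists_countPoly Q hQB
  -- [3] the permanent form of its Boolean sum
  obtain ⟨N, K, B, hNK, hB, hper⟩ := ArithCircuit.exists_permanent_boolSum P hP2 hPc
  have hPg : P.gates.length ≤ 60 * S + 1 := by unfold ArithCircuit.size at hPs; omega
  have hNKle : N + K ≤ CF := hNK.trans ((cfBound_mono hPg (hPd.trans (by omega)) (by omega)).trans hCF)
  -- the value of the Boolean sum at `x`
  set cnt : (Fin n → Bool) → ℕ := fun x =>
    (Finset.univ.filter fun y : Fin m → Bool => Q.eval (Sum.elim x y) = true).card with hcnt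
  have hcnt_eq : ∀ x, countWitnesses R m (List.ofFn x) = cnt x := fun x =>
    countWitnesses_eq_card_filter R m (List.ofFn x) _ fun y => by
      rw [hQe, ← Set.mem_iff_boolIndicator]
      simp only [Sum.elim_inl, Sum.elim_inr]
      exact Iff.rfl
  have hcnt_le : ∀ x, cnt x ≤ 2 ^ m := fun x =>
    (Finset.card_filter_le _ _).trans (by simp [Finset.card_univ])
  have heval : ∀ x : Fin n → Bool, eval (toK ℤ ∘ x) B.permanent = ((2 ^ K * cnt x : ℕ) : ℤ) := by
    intro x
    have hPe' : P.eval = G := hPe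
    rw [hper, map_mul, hPe', hG x]
    simp [hcnt]
  -- [3'] the cost of the permanent form
  have hτ : constantFreeComplexity B.permanent ≤ CF ^ c + c + CF * CF * (60 * S + 2) := by
    have h1 := constantFreeComplexity_permanent_le B
    have h2 : ∑ ij : Fin N × Fin N, constantFreeComplexity (B ij.1 ij.2) ≤ N * N * (60 * S + 2) := by
      calc ∑ ij : Fin N × Fin N, constantFreeComplexity (B ij.1 ij.2)
          ≤ ∑ _ij : Fin N × Fin N, (60 * S + 2) := Finset.sum_le_sum fun ij _ =>
            ((hB ij.1 ij.2).constantFreeComplexity_le_succ).trans (by omega)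
        _ = N * N * (60 * S + 2) := by
            simp [Finset.sum_const, Finset.card_univ, Fintype.card_prod, Fintype.card_fin]
    have hN : N ≤ CF := by omega
    have h3 : constantFreeComplexity (perPoly (Fin N) ℤ) ≤ CF ^ c + c :=
      (hc N).trans (Nat.add_le_add_right (Nat.pow_le_pow_left hN c) c)
    have h4 : N * N * (60 * S + 2) ≤ CF * CF * (60 * S + 2) := by gcongr
    omega
  -- [4] an optimal circuit for `per B`, simulated modulo `2^ℓ`
  obtain ⟨Rc, hRc2, hRcc, hRce, hRcs⟩ := exists_computes_size_eq_constantFreeComplexity B.permanent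
  set ℓ : ℕ := K + m + 1 with hℓ
  haveI : NeZero (2 ^ ℓ) := ⟨pow_ne_zero _ two_ne_zero⟩
  have hsim := cktSize_testBits_aeval_eval (p := 2 ^ ℓ) le_rfl
    (fun (x : Fin n → Bool) (v : Fin n) => if x v then (1 : ZMod (2 ^ ℓ)) else 0)
    (fun v => cktSize_inputResidue' (ι := Fin n) (by omega) v) Rc hRc2
  -- the simulated value is `2^K · cnt x`
  have hval : ∀ x : Fin n → Bool,
      (aeval (fun v => if x v then (1 : ZMod (2 ^ ℓ)) else 0) Rc.eval).val = 2 ^ K * cnt x := by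
    intro x
    have hz : (fun v => if x v then (1 : ZMod (2 ^ ℓ)) else 0) = fun v => (((toK ℤ ∘ x) v : ℤ) : ZMod (2 ^ ℓ)) := by
      funext v
      by_cases h : x v <;> simp [toK, h]
    have hRce' : Rc.eval = B.permanent := hRce
    rw [hz, hRce', aeval_intCast_point, heval x, Int.cast_natCast, ZMod.val_natCast_of_lt]
    calc 2 ^ K * cnt x ≤ 2 ^ K * 2 ^ m := Nat.mul_le_mul_left _ (hcnt_le x)
      _ = 2 ^ (K + m) := (pow_add _ _ _).symm
      _ < 2 ^ ℓ := Nat.pow_lt_pow_right (by norm_num) (by omega)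
  -- [5] output bits `K, …, K + m`
  refine ((hsim.outMap fun i : Fin (m + 1) => (⟨K + i, by omega⟩ : Fin ℓ)).congr fun x i => ?_).of_le ?_
  · simp only [testBits_apply]
    rw [hval x, Nat.testBit_two_pow_mul, hcnt_eq x]
    simp
  · -- size
    refine Nat.mul_le_mul (Nat.succ_le_succ (hRcs ▸ hτ)) ((gateCost_le ℓ 1).trans ?_)
    have : (ℓ + 2) ^ 3 ≤ (CF + m + 3) ^ 3 := Nat.pow_le_pow_left (by omega) 3
    omega

/-! ### `#P ⊆ FP/poly`, `P^{#P} ⊆ P/poly`, `PP ⊆ P/poly` -/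

/-- **`τ(PER_n) = n^{O(1)} ⟹ #P ⊆ FP/poly`**: every `#P` function has polynomial-size circuits for
its bits (Bürgisser, ECCC TR06-113, proof of Lemma 2.12: "the result … the integer value of the
permanent … can be retrieved", for the permanent form of the counting function). [cite: Burgisser2006, Lemma 2.12] -/
theorem sharpP_bitCircuits_of_isPBounded_perPoly
    (hτ : IsPBounded fun n => constantFreeComplexity (perPoly (Fin n) ℤ))
    {f : List Bool → ℕ} (hf : f ∈ SharpP) : Nonempty (BitCircuits f) := by
  obtain ⟨c, hc⟩ := hτ
  obtain ⟨R, hRP, p, hfR⟩ := hf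
  obtain ⟨q, hq⟩ := exists_cktSize_boolPair_of_mem_PPoly (P_subset_PPoly_holds hRP)
  -- the certificate length and the pair-circuit size as p-bounded functions of the input length
  set pf : ℕ → ℕ := fun n => p.eval n with hpf
  set S : ℕ → ℕ := fun n => (2 * n + 2 + pf n) + q.eval (2 * n + 2 + pf n) with hS
  have hp : IsPBounded pf := (isPBounded_iff_exists_polynomial_holds pf).2 ⟨p, fun n => le_rfl⟩
  have hlin : IsPBounded fun n => 2 * n + 2 + pf n :=
    IsPBounded.add_holds (IsPBounded.add_holds (IsPBounded.mul_holds (IsPBounded.const 2) IsPBounded.id)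
      (IsPBounded.const 2)) hp
  have hq' : IsPBounded fun k => q.eval k := (isPBounded_iff_exists_polynomial_holds _).2 ⟨q, fun n => le_rfl⟩
  have hSb : IsPBounded S := IsPBounded.add_holds hlin (IsPBounded.comp_holds hq' hlin)
  obtain ⟨s, hs⟩ := (isPBounded_iff_exists_polynomial_holds _).1 (isPBounded_size212 c hp hSb)
  refine ⟨{ K := p + 1, s := s, lt := fun x => ?_, ckt := fun n => ?_ }⟩
  · -- `f x ≤ 2^{p |x|} < 2^{p |x| + 1}` (cf. `Stockmeyer.countWitnesses_le_two_pow`, not imported)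
    rw [hfR x, Polynomial.eval_add, Polynomial.eval_one, pow_succ]
    have : countWitnesses R (p.eval x.length) x ≤ 2 ^ p.eval x.length := by
      classical
      unfold countWitnesses
      exact (Finset.card_filter_le _ _).trans (by simp [Finset.card_univ, card_vector])
    have h1 : 1 ≤ 2 ^ p.eval x.length := Nat.one_le_two_pow
    omega
  · have key := (cktSize_testBit_countWitnesses hc R n (pf n) (S n) _ le_rfl (hq n (pf n))).of_le (hs n)
    have e : (p + 1).eval n = pf n + 1 := by simp [hpf]
    refine (key.outMap fun i : Fin ((p + 1).eval n) => Fin.cast e i).congr fun x i => ?_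
    simp only [Fin.val_cast]
    rw [hfR, List.length_ofFn]

/-- Hence **`P^f ⊆ P/poly` for every `f ∈ #P`** under `τ(PER_n) = n^{O(1)}` (the bit graph of `f` is
in `P/poly` and `P/poly` is closed under polynomial-time Turing reductions, `BitGraphPPoly.lean`). [cite: Burgisser2006, Lemma 2.12] -/
theorem PRel_sharpP_subset_PPoly_of_isPBounded_perPoly
    (hτ : IsPBounded fun n => constantFreeComplexity (perPoly (Fin n) ℤ))
    {f : List Bool → ℕ} (hf : f ∈ SharpP) : PRel (Oracle.ofFun f) ⊆ PPoly := by
  obtain ⟨B⟩ := sharpP_bitCircuits_of_isPBounded_perPoly hτ hf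
  exact B.PRel_ofFun_subset_PPoly_of_bitCircuits

/-- Hence **`P^{#P} ⊆ P/poly`** under `τ(PER_n) = n^{O(1)}`. [cite: Burgisser2006, Lemma 2.12] -/
theorem PSharpP_subset_PPoly_of_isPBounded_perPoly
    (hτ : IsPBounded fun n => constantFreeComplexity (perPoly (Fin n) ℤ)) : PSharpP ⊆ PPoly := by
  intro L hL
  obtain ⟨f, hf, hLf⟩ := Set.mem_iUnion₂.1 hL
  exact PRel_sharpP_subset_PPoly_of_isPBounded_perPoly hτ hf hLf

/-- **Discharge of Bürgisser's Lemma 2.12** (ECCC TR06-113, Lemma 2.12, p. 8; STACS 2007, Lemma 11):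
`τ(PER_n) = n^{O(1)}` implies `PP ⊆ P/poly` — `PP ⊆ P^{#P}` (`PP_subset_PSharpP_holds`) and
`P^{#P} ⊆ P/poly` (`PSharpP_subset_PPoly_of_isPBounded_perPoly`). The named fact
`PP_subset_PPoly_of_isPBounded_perPoly` of `TauConjectureProofs.lean` is a theorem. [cite: Burgisser2006, Lemma 2.12] -/
theorem PP_subset_PPoly_of_isPBounded_perPoly_holds : PP_subset_PPoly_of_isPBounded_perPoly :=
  fun hτ _L hL => PSharpP_subset_PPoly_of_isPBounded_perPoly hτ (PP_subset_PSharpP_holds hL)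

end Literature.Computability.AlgebraicComplexity
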